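import Literature.MathematicalPhysics.QuantumFieldTheory.Balaban1983to89.B8Ineq165Local
import Literature.MathematicalPhysics.QuantumFieldTheory.Balaban1983to89.B8Eq119TwistedAxial
import Literature.MathematicalPhysics.QuantumFieldTheory.Balaban1983to89.B8Eq131Cubes
import Literature.MathematicalPhysics.QuantumFieldTheory.Balaban1983to89.B8Eq106Local

/-!
# `Balaban1983to89.B8Ineq166Univ` — [Balaban1985RegularSpaces] p. 87 (1.65) ⇒ (1.66) AT THE FINEST LEVEL ON ALL BONDS OF `ℤᵈ`, for a
# region sequence with `Ω₀ = ℤᵈ` (print p. 77: «we admit the case where some domains Ω_j are equal to T_η»): «the conditions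
# (1.33)–(1.35) imply |Ũ′ʲ − 1| < 11d²α₀ + α₁» — the missing estimate of THEOREM 2 on the `Ω 0 = univ` sub-family of the N05 prototype

statement-level skeleton of published theorems with citation tags; proofs where landed; nothing here is a claim about the
Yang–Mills mass gap

PDF held: `paper:balaban1985-cmp99-regular-spaces-gauge-fixing` (journal page = PDF page + 74); p. 77 ((1.3)–(1.6)), p. 79 ((1.19)–(1.20)),
p. 82 ((1.33)–(1.35)), p. 87 ((1.65)–(1.66)).

WHY THIS FILE (cell `pub-ymgap`, seat `pub-ymgap-dag-n05-a` g5, KNIT seat of DAG node N05 = [B8]; count-neutral).  Theorem 4's hypothesis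
(1.66)₀ — `‖U′_b − 1‖ ≤ α` on the bonds of `Ω₀` — is in print DERIVED from (1.33)–(1.35) by (1.65) (Lemma 1 iterated, p. 87); this is the
step by which «Theorem 4 implies Theorem 2» (p. 88).  The tree has (1.65) on ONE tower of same-level cubes (`B8Ineq165Local.ineq165_local`,
lit-balaban p26).  Here it is assembled on EVERY bond of `ℤᵈ` for a region sequence whose towers COVER `ℤᵈ` (`Ω 0 = univ`, the sub-family on
which Theorem 2 is not refuted — `B8LeafModelZd3Boundary`): a bond `⟨x, x + e_μ⟩` with `x` in a tower of level `j` and `x + e_μ` in a tower of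
level `j′` is handled at the level `m = min j j′` on the box of the two (equal or adjacent) level-`m` blocks containing its end-points — the
(1.7) inputs on that box come from `U₀, U′U₀ ∈ 𝔄_k` on `Ω_m ⊇` both blocks, the block axial gauge (1.19) inside the box from
`Ax_k(𝔅_k, U₀)` along the two towers, and the top closeness (1.35) on the one crossing bond of the box (both of whose blocks lie in `Ω_m`).

WHAT IS PROVED (kernel, 0 sorry, theorems only): block-nesting bookkeeping (`flm_under_of_under`, `under_add_of_under`,
`under_or_of_box_pair`, `flm_succ_coord`), `pdevOn_box_lt_of_inAk`, and **`norm_pert_sub_one_le_univ`**: under (1.33) `InAk … U₀`, (1.34)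
`InAk … (U′U₀)` + `InAx L k Λs U₀ (U′U₀)`, (1.35) in the box form on every level-`j` bond whose two blocks lie in `Ω_j` (`j ≤ k`), towers
`Bʲ(y) ⊂ Ω_j` (`y ∈ Λs j`) COVERING `ℤᵈ`, and the windows of (1.65): `‖U′_b − 1‖ ≤ 11d²α₀ + α₁` for EVERY bond `b`.

HONEST SCOPE.  (1.65) itself is lit-balaban's `ineq165_local_pert` BY NAME; this file is its all-bonds assembly for covering towers; windows
as there (`C₀α₀ ≤ 1/3`, `2α₀ ≤ c₂′`, `11d²α₀ + α₁ ≤ 1/6`); `≤` for print's `<`; `T_η ↦ ℤᵈ`.  Count-neutral; N05 NOT discharged; nothing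
continuum / ℝ⁴ / OS / mass-gap / Clay.  Unit `pub-ymgap-dag-n05-a` (g5), 2026-08-26.
-/

noncomputable section

open scoped BigOperators

namespace Literature.MathematicalPhysics.QuantumFieldTheory.Balaban1983to89.B8Ineq166Univ

open B7Prop1Explicit B7Prop2Explicit B7Prop1Local B8Lemma1NonAbelian B8Ineq130
open B8Ineq132 (InAk Under)
open B8Eq119TwistedAxial (InAx inAx_iff)
open B8Eq131Cubes (flm under_flm)
open B8Eq106Local (under_iff_tower)

-- `Site` alone would resolve to the torus sites of `Setup.lean`; re-export the `ℤ^d` sites of `B7Prop1Explicit`.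
export B7Prop1Explicit (Site)

variable {d : ℕ}

/-! ## §1 Block-nesting bookkeeping -/

/-- **Intermediate ancestors stay in the tower**: if `x ∈ Bʲ(y)` and `m ≤ j`, the level-`m` block of `x` lies under `y` at depth `j − m`:
`flm L m x ∈ B^{j−m}(y)`. [cite: Balaban1985RegularSpaces, p.79 («x_n ∈ B(x_{n+1}), n = 0, 1, …, j − 1»)] -/
theorem flm_under_of_under {L : ℕ} (hL : 1 ≤ L) {j m : ℕ} (hmj : m ≤ j) {y x : Site d} (hx : Under L j y x) :
    Under L (j - m) y (flm L m x) := by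
  intro i
  obtain ⟨h1, h2⟩ := hx i
  have hL0 : (0 : ℤ) < L := by exact_mod_cast hL
  have hP : (0 : ℤ) < (L : ℤ) ^ m := by positivity
  have hpow : (L : ℤ) ^ j = (L : ℤ) ^ m * (L : ℤ) ^ (j - m) := by
    rw [← pow_add, Nat.add_sub_cancel' hmj]
  constructor
  · have h1' : (L : ℤ) ^ m * ((L : ℤ) ^ (j - m) * y i) ≤ x i := by
      calc (L : ℤ) ^ m * ((L : ℤ) ^ (j - m) * y i) = (L : ℤ) ^ j * y i := by rw [hpow]; ring
        _ ≤ x i := h1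
    show (L : ℤ) ^ (j - m) * y i ≤ x i / (L : ℤ) ^ m
    exact Int.le_ediv_of_mul_le hP (by rw [mul_comm]; exact h1')
  · have h2' : x i < (L : ℤ) ^ (j - m) * (y i + 1) * (L : ℤ) ^ m := by
      calc x i < (L : ℤ) ^ j * (y i + 1) := by linarith
        _ = (L : ℤ) ^ (j - m) * (y i + 1) * (L : ℤ) ^ m := by rw [hpow]; ring
    show x i / (L : ℤ) ^ m + 1 ≤ (L : ℤ) ^ (j - m) * (y i + 1)
    have := Int.ediv_lt_of_lt_mul hP h2'
    linarith

/-- **Composition of depths**: `z ∈ Bᵃ(y)` and `w ∈ Bᵇ(z)` ⇒ `w ∈ B^{a+b}(y)` (`B8Ineq132.under_tower` in the `Under` spelling).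
[cite: Balaban1985RegularSpaces, p.79 («x_n ∈ B(x_{n+1})»)] -/
theorem under_add_of_under {L : ℕ} {a b : ℕ} {y z w : Site d} (hz : Under L a y z) (hw : Under L b z w) : Under L (a + b) y w := by
  obtain ⟨h1, h2⟩ := (under_iff_tower L a y z).1 hz
  exact (under_iff_tower L (a + b) y w).2 (B8Ineq132.under_tower h1 h2 hw)

/-- **The box of two level-`n` blocks `[tlo L z n, thi L z′ n]` with `z′ = z` or `z′ = z + e_μ`**: every site of it lies under `z` or under `z′`.
[cite: Balaban1985Averaging, p.24 (the box `B(c₋) ∪ B(c₊)` of a bond)] -/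
theorem under_or_of_box_pair {L : ℕ} (n : ℕ) {z z' : Site d} {μ : Fin d} (hz' : z' = z ∨ z' = z + e μ) {w : Site d}
    (hlo : tlo L z n ≤ w) (hhi : w ≤ thi L z' n) : Under L n z w ∨ Under L n z' w := by
  rcases hz' with h | h
  · left
    rw [h] at hhi
    exact (under_iff_tower L n z w).2 ⟨hlo, hhi⟩
  · by_cases hμ : w μ + 1 ≤ (L : ℤ) ^ n * (z μ + 1)
    · refine Or.inl fun i => ⟨by have := hlo i; rwa [tlo_apply] at this, ?_⟩
      by_cases hi : i = μ
      · subst hi; exact hμ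
      · have h1 := hhi i
        rw [thi_apply, h] at h1
        have he : (z + e μ) i = z i := by simp [e_apply, hi]
        rw [he] at h1
        linarith
    · refine Or.inr fun i => ⟨?_, by have := hhi i; rw [thi_apply] at this; linarith⟩
      rw [h]
      by_cases hi : i = μ
      · subst hi
        have he : (z + e i) i = z i + 1 := by simp [e_apply]
        rw [he]
        have hμ' := not_le.mp hμ
        linarith
      · have h1 := hlo i
        rw [tlo_apply] at h1
        have he : (z + e μ) i = z i := by simp [e_apply, hi]
        rw [he]
        exact h1

/-- **The level-`m` blocks of the end-points of a bond are equal or adjacent**: `flm L m (x + e_μ) = flm L m x` or `= flm L m x + e_μ`.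
[cite: Balaban1985Averaging, p.24 (the box of a bond)] -/
theorem flm_succ_coord {L : ℕ} (hL : 1 ≤ L) (m : ℕ) (x : Site d) (μ : Fin d) :
    flm L m (x + e μ) = flm L m x ∨ flm L m (x + e μ) = flm L m x + e μ := by
  have hP : (0 : ℤ) < (L : ℤ) ^ m := by positivity
  have hkey : (x μ + 1) / (L : ℤ) ^ m = x μ / (L : ℤ) ^ m ∨ (x μ + 1) / (L : ℤ) ^ m = x μ / (L : ℤ) ^ m + 1 := by
    have h1 : x μ / (L : ℤ) ^ m ≤ (x μ + 1) / (L : ℤ) ^ m := Int.ediv_le_ediv hP (by linarith)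
    have h2 : (x μ + 1) / (L : ℤ) ^ m ≤ x μ / (L : ℤ) ^ m + 1 := by
      have h3 : (x μ + 1) / (L : ℤ) ^ m ≤ (x μ + 1 * (L : ℤ) ^ m) / (L : ℤ) ^ m :=
        Int.ediv_le_ediv hP (by linarith [show (1 : ℤ) ≤ (L : ℤ) ^ m from by exact_mod_cast Nat.one_le_pow _ _ hL])
      rw [Int.add_mul_ediv_right _ _ hP.ne'] at h3
      exact h3
    omega
  rcases hkey with h | h
  · left
    funext i
    by_cases hi : i = μ
    · subst hi; simp [flm, e_apply, h]
    · simp [flm, e_apply, hi]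
  · right
    funext i
    by_cases hi : i = μ
    · subst hi; simp [flm, e_apply, h]
    · simp [flm, e_apply, hi]

/-! ## §2 (1.7) on a box of sites in `Ω_j` -/

section Cfg

variable {𝔸 : Type*} [NormedRing 𝔸] [NormedAlgebra ℂ 𝔸]

/-- **(1.7) on a box whose sites lie in `Ω_j`** from `U ∈ 𝔄_k({Ω_j}, α)` (`InAk`; the plaquette clause on plaquettes touching `Ω_j`):
`pdevOn lo hi U < αL^{−2j}` — the box version of `B8Thm4AtLandau138.pdevOn_tower_lt_of_inAk`. [cite: Balaban1985RegularSpaces, (1.7) p.77, (1.33) p.82] -/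
theorem pdevOn_box_lt_of_inAk {L : ℕ} (hL : 1 ≤ L) {k : ℕ} {η α : ℝ} (hα : 0 < α) {Ω : ℕ → Set (Site d)}
    {U : Site d → Fin d → 𝔸ˣ} (hA : InAk L k η α Ω U) {j : ℕ} (hj : j ≤ k) {lo hi : Site d}
    (hbox : ∀ x, InBox lo hi x → x ∈ Ω j) : pdevOn lo hi U < α * (((L : ℝ) ^ j)⁻¹) ^ 2 := by
  have hL0 : 0 < L := hL
  refine B8Ineq132.pdevOn_lt_of_forall (by positivity) fun x μ ν hx _ => ?_
  rcases eq_or_ne μ ν with rfl | hμν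
  · rw [hol_plaqWord_self, Units.val_one, sub_self, norm_zero]; positivity
  · exact (hA j hj).1 x μ ν hμν (Or.inl (hbox x hx))

end Cfg

/-! ## §3 (1.65) ⇒ (1.66) at the finest level on ALL bonds, towers covering `ℤᵈ` -/

section Univ

variable {𝔸 : Type*} [CStarAlgebra 𝔸] [Nontrivial 𝔸]

/-- **(1.66)₀ ON EVERY BOND OF `ℤᵈ` FROM (1.33)–(1.35)** (p. 87 «Thus the conditions (1.33)–(1.35) imply |Ũ′ʲ − 1| < 11d²α₀ + α₁ on Ω_j^{(j)}»,
at `j = 0` with `Ω₀ = ℤᵈ`): for unitary-valued `U₀`, `U′` on `ℤᵈ` with (1.33) `U₀ ∈ 𝔄_k({Ω_j}, α₀)`, (1.34) `U′U₀ ∈ 𝔄_k({Ω_j}, α₀) ∩ Ax_k(𝔅_k, U₀)`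
(`InAk` + `InAx L k Λs U₀ (U′U₀)`), (1.35) in the box form `‖(U′U₀)‾ʲ(c) − Ū₀ʲ(c)‖ ≤ α₁` on every level-`j` bond `c` whose two blocks lie in
`Ω_j` (`j ≤ k`), towers `Bʲ(y) ⊂ Ω_j` for `y ∈ Λs j` COVERING `ℤᵈ`, `Ω` antitone, and the windows of (1.65): `‖U′_b − 1‖ ≤ 11d²α₀ + α₁` at EVERY
bond `b = ⟨x, x + e_μ⟩`.  PROOF: `x ∈ Bʲ(y)`, `x + e_μ ∈ B^{j′}(y′)`; at `m = min j j′` the level-`m` blocks `z, z′` of the end-points are equal or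
adjacent (`flm_succ_coord`) and lie in `Ω_m` with their towers; lit-balaban's `B8Ineq165Local.ineq165_local_pert` on the box `[z, z′]` at depth `m`,
its (1.7) inputs by `pdevOn_box_lt_of_inAk`, its (1.19) inputs from `InAx` along the two towers (`inAx_iff`, `flm_under_of_under`,
`under_add_of_under`, `under_or_of_box_pair`), its (1.35) input = the one crossing bond. [cite: Balaban1985RegularSpaces, (1.65)–(1.66) p.87, (1.33)–(1.35) p.82, (1.19)–(1.20) p.79, p.77] -/
theorem norm_pert_sub_one_le_univ (hd : 1 ≤ d) {L : ℕ} (hL : 2 ≤ L) (k : ℕ) {η : ℝ}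
    {U₀ U' : Site d → Fin d → 𝔸ˣ} (hU₀ : ∀ x κ, U₀ x κ ∈ unitaryUnits 𝔸) (hU' : ∀ x κ, U' x κ ∈ unitaryUnits 𝔸)
    {α₀ α₁ : ℝ} (hα₀ : 0 < α₀) (hα3 : C0 d * α₀ ≤ 1 / 3) (hα2 : 2 * α₀ ≤ c2' d L) (hα₁ : 0 ≤ α₁)
    (hsmall : 11 * (d : ℝ) ^ 2 * α₀ + α₁ ≤ 1 / 6)
    (Ω : ℕ → Set (Site d)) (hΩ : ∀ j, Ω (j + 1) ⊆ Ω j) (Λs : ℕ → Set (Site d))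
    (htower : ∀ j, j ≤ k → ∀ y ∈ Λs j, ∀ x, InBox (tlo L y j) (thi L y j) x → x ∈ Ω j)
    (hpart : ∀ x : Site d, ∃ j, j ≤ k ∧ ∃ y ∈ Λs j, InBox (tlo L y j) (thi L y j) x)
    (h33 : InAk L k η α₀ Ω U₀) (h34 : InAk L k η α₀ Ω (mulCfg U' U₀)) (hAx : InAx L k Λs U₀ (mulCfg U' U₀))
    (h135 : ∀ j, j ≤ k → ∀ (z : Site d) (μ : Fin d), (∀ x, InBox (loK L j z) (bondHiK L j z μ) x → x ∈ Ω j) →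
      ‖(avgIter L (mulCfg U' U₀) j z μ : 𝔸) - (avgIter L U₀ j z μ : 𝔸)‖ ≤ α₁)
    (x : Site d) (μ : Fin d) : ‖((U' x μ : 𝔸ˣ) : 𝔸) - 1‖ ≤ 11 * (d : ℝ) ^ 2 * α₀ + α₁ := by
  have hL1 : 1 ≤ L := le_trans (by norm_num) hL
  have hG : AvgClosed d L (unitaryUnits 𝔸) := avgClosed_unitaryUnits d L
  set U : Site d → Fin d → 𝔸ˣ := mulCfg U' U₀ with hU_def
  have hU : ∀ x κ, U x κ ∈ unitaryUnits 𝔸 := fun x κ => (unitaryUnits 𝔸).mul_mem (hU' x κ) (hU₀ x κ)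
  -- antitonicity of `Ω` between arbitrary levels
  have hΩle : ∀ {a b : ℕ}, a ≤ b → Ω b ⊆ Ω a := by
    intro a b hab
    induction hab with
    | refl => exact le_rfl
    | step _ ih => exact (hΩ _).trans ih
  -- the towers of the two end-points
  obtain ⟨j, hj, y, hy, hx⟩ := hpart x
  obtain ⟨j', hj', y', hy', hx'⟩ := hpart (x + e μ)
  have hxu : Under L j y x := (under_iff_tower L j y x).2 ⟨fun i => (hx i).1, fun i => (hx i).2⟩
  have hxu' : Under L j' y' (x + e μ) := (under_iff_tower L j' y' (x + e μ)).2 ⟨fun i => (hx' i).1, fun i => (hx' i).2⟩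
  -- the common level `m = min j j'` and the level-`m` blocks of the end-points
  set m : ℕ := min j j' with hm_def
  have hmj : m ≤ j := min_le_left _ _
  have hmj' : m ≤ j' := min_le_right _ _
  have hmk : m ≤ k := hmj.trans hj
  set z : Site d := flm L m x with hz_def
  set z' : Site d := flm L m (x + e μ) with hz'_def
  have hzx : Under L m z x := under_flm hL1 m x
  have hzx' : Under L m z' (x + e μ) := under_flm hL1 m (x + e μ)
  have hzz' : z' = z ∨ z' = z + e μ := flm_succ_coord hL1 m x μ
  have hzy : Under L (j - m) y z := flm_under_of_under hL1 hmj hxu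
  have hzy' : Under L (j' - m) y' z' := flm_under_of_under hL1 hmj' hxu'
  -- every site under `z` (resp. `z'`) at depth `n ≤ m`... lies in the tower of `y` (resp. `y'`), hence in `Ω_m` at depth `m`
  have hΩz : ∀ w, Under L m z w → w ∈ Ω m := by
    intro w hw
    have h1 : Under L (j - m + m) y w := under_add_of_under hzy hw
    rw [Nat.sub_add_cancel hmj] at h1
    have h1' := (under_iff_tower L j y w).1 h1
    exact hΩle hmj (htower j hj y hy w fun i => ⟨h1'.1 i, h1'.2 i⟩)
  have hΩz' : ∀ w, Under L m z' w → w ∈ Ω m := by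
    intro w hw
    have h1 : Under L (j' - m + m) y' w := under_add_of_under hzy' hw
    rw [Nat.sub_add_cancel hmj'] at h1
    have h1' := (under_iff_tower L j' y' w).1 h1
    exact hΩle hmj' (htower j' hj' y' hy' w fun i => ⟨h1'.1 i, h1'.2 i⟩)
  have hboxΩ : ∀ w, InBox (tlo L z m) (thi L z' m) w → w ∈ Ω m := by
    intro w hw
    rcases under_or_of_box_pair m hzz' (fun i => (hw i).1) (fun i => (hw i).2) with h | h
    · exact hΩz w h
    · exact hΩz' w h
  have hlohi : z ≤ z' := by
    rcases hzz' with h | h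
    · rw [h]
    · rw [h]; exact le_add_of_nonneg_right (e_nonneg μ)
  -- (1.7) inputs on the box
  have h33' : pdevOn (tlo L z m) (thi L z' m) U₀ < α₀ * (((L : ℝ) ^ m)⁻¹) ^ 2 := pdevOn_box_lt_of_inAk hL1 hα₀ h33 hmk hboxΩ
  have h34' : pdevOn (tlo L z m) (thi L z' m) U < α₀ * (((L : ℝ) ^ m)⁻¹) ^ 2 := pdevOn_box_lt_of_inAk hL1 hα₀ h34 hmk hboxΩ
  -- (1.19) inputs on the box, from `Ax_k(𝔅_k, U₀)` along the two towers
  have hAx' := (inAx_iff L k Λs U₀ U).1 hAx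
  have h19 : ∀ n, n < m → ∀ w, tlo L z n ≤ w → w ≤ thi L z' n → ∀ r : Fin d → Fin L,
      axialFn (avgIter L U (m - (n + 1))) ((L : ℤ) • w) ((L : ℤ) • w + boxVec L r) =
        axialFn (avgIter L U₀ (m - (n + 1))) ((L : ℤ) • w) ((L : ℤ) • w + boxVec L r) := by
    intro n hn w hlo hhi r
    rcases under_or_of_box_pair n hzz' hlo hhi with hw | hw
    · -- under `z`, hence under `y` at depth `j - m + n`; level data `j ≥ 1`, `m - (n+1) < j`
      have h1 : Under L (j - m + n) y w := under_add_of_under hzy hw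
      have hj1 : 1 ≤ j := by omega
      have hdepth : j - (m - (n + 1) + 1) = j - m + n := by omega
      exact hAx' j hj1 hj y hy (m - (n + 1)) (by omega) w (by rw [hdepth]; exact h1) r
    · have h1 : Under L (j' - m + n) y' w := under_add_of_under hzy' hw
      have hj1 : 1 ≤ j' := by omega
      have hdepth : j' - (m - (n + 1) + 1) = j' - m + n := by omega
      exact hAx' j' hj1 hj' y' hy' (m - (n + 1)) (by omega) w (by rw [hdepth]; exact h1) r
  -- (1.35) input: the one crossing bond of the box (if any)
  have h35 : ∀ (w : Site d) (ν : Fin d), z ≤ w → w + e ν ≤ z' →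
      ‖((avgIter L U m w ν : 𝔸ˣ) : 𝔸) - avgIter L U₀ m w ν‖ ≤ α₁ := by
    intro w ν hzw hwz'
    -- then `ν = μ`, `z' = z + e μ` and `w = z`
    have hνμ : z' = z + e μ ∧ ν = μ := by
      rcases hzz' with h | h
      · exfalso
        have h1 := hwz' ν
        have h2 := hzw ν
        rw [h] at h1
        simp [e_apply] at h1
        linarith
      · refine ⟨h, ?_⟩
        by_contra hne
        have h1 := hwz' ν
        have h2 := hzw ν
        rw [h] at h1
        simp [e_apply, hne] at h1
        linarith
    obtain ⟨hz'eq, rfl⟩ := hνμ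
    have hwz : w = z := by
      funext i
      have h1 := hwz' i
      have h2 := hzw i
      rw [hz'eq] at h1
      simp only [Pi.add_apply] at h1
      linarith
    rw [hwz]
    refine h135 m hmk z ν fun v hv => hboxΩ v fun i => ?_
    have h1 := hv i
    simp only [loK, bondHiK] at h1
    rw [tlo_apply, thi_apply, hz'eq, Pi.add_apply, e_apply]
    by_cases hi : i = ν
    · rw [if_pos hi] at h1; rw [if_pos hi]; constructor <;> linarith [h1.1, h1.2]
    · rw [if_neg hi] at h1; rw [if_neg hi]; constructor <;> linarith [h1.1, h1.2]
  -- (1.65) on the box at depth `m` (lit-balaban p26), perturbation member, at the finest level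
  have hV₀ : avgIter L U₀ (m - m) x μ ∈ U1 𝔸 := by
    rw [Nat.sub_self, avgIter_zero]; exact unitaryUnits_le_U1 (hU₀ x μ)
  have hxlo : tlo L z m ≤ x := ((under_iff_tower L m z x).1 hzx).1
  have hxhi : x + e μ ≤ thi L z' m := ((under_iff_tower L m z' (x + e μ)).1 hzx').2
  have h := B8Ineq165Local.ineq165_local_pert L hL hd hG m U₀ U hU₀ hU hα₀ hα3 hα2 z z' hlohi h33' h34' h19 h35 hα₁ hsmall
    m le_rfl x μ hV₀ hxlo hxhi
  rw [Nat.sub_self, avgIter_zero, avgIter_zero] at h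
  have hpert : pert U U₀ x μ = U' x μ := by
    simp [pert, hU_def, mulCfg]
  rw [hpert] at h
  exact h.le

end Univ

#print axioms norm_pert_sub_one_le_univ

end Literature.MathematicalPhysics.QuantumFieldTheory.Balaban1983to89.B8Ineq166Univ

end
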